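import Literature.InformationTheory.StateDiscrimination.QuantumFisherMatrixCovarianceBound
import HarnessLib

/-!
# Sensitivity bound for mode-separable states: `𝐅_Q[ρ̂_m-sep, Ĥ] ≤ 4Γ[ρ̂₁⊗ρ̂₂, Ĥ]` — the quantum Fisher matrix of a
# mixture of mode-product states is bounded by four times the covariance of the generators in the REDUCED states
# (Gessner–Pezzè–Smerzi 2018, Eq. (12); two modes)

Hodge foundations lane (`lit-hodgefound`, prover p24 gen 80; quantum-information series).  THEOREMS ONLY: no
definition, no named fact, net debt 0.  Two modes with Hilbert spaces `ℂ^{n₁}`, `ℂ^{n₂}`; a mode-separable state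
`ρ̂ = Σ_γ p_γ ρ̂_{1,γ} ⊗ ρ̂_{2,γ}` (finite index `γ`); generator families `K_a = h₁ a ⊗ 1 + 1 ⊗ h₂ a` acting locally
on the two modes (GPS: `h₁ = (Ĥ₁, 0)`, `h₂ = (0, Ĥ₂)`, one parameter per mode — here arbitrary local families);
derivative data `∂_aρ̂ = i(ρ̂K_a − K_aρ̂)` (unitary encoding), SLDs in the BF normalisation (`Sρ + ρS = ∂ρ`, any
choice — `S_{k,γ} a` on mode `k` of component `γ`, `T a` for the mixture), QFIM `F_ab = 2Re Tr(T_a∂_bρ̂)` as in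
g80-#1…#3, and the covariance matrices of the local families in the reduced states `ρ̂_k = Σ_γ p_γρ̂_{k,γ}`,
`Γ_k[a,b] = ½⟨{h_k a, h_k b}⟩_{ρ̂_k} − ⟨h_k a⟩_{ρ̂_k}⟨h_k b⟩_{ρ̂_k}`.

## Source, VERBATIM

M. Gessner, L. Pezzè, A. Smerzi, *Sensitivity bounds for multiparameter quantum metrology*, Phys. Rev. Lett. 121
(2018) 130503 [GessnerPezzeSmerzi2018], held `paper:arxiv-1806.05665`, p0004: «Sensitivity bounds for mode-separable
states.—Let us now determine the upper sensitivity limits for general mode-separable states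
`ρ̂_m-sep = Σ_γ p_γ ρ̂_{1,γ} ⊗ ⋯ ⊗ ρ̂_{M,γ}`, where `ρ̂_{k,γ}` is an arbitrary density matrix of mode `k`. The
state-dependent bound `𝐅_Q[ρ̂_m-sep, Ĥ] ≤ 4Γ[ρ̂₁ ⊗ ⋯ ⊗ ρ̂_M, Ĥ]` (12) holds, where
`Γ[ρ̂₁ ⊗ ⋯ ⊗ ρ̂_M, Ĥ] = diag((ΔĤ₁)²_{ρ̂₁}, …, (ΔĤ_M)²_{ρ̂_M})` is the covariance matrix of the product state of
reduced density matrices `ρ̂_k = Σ_γ p_γ ρ̂_{γ,k}` for the different modes `k` [GessnerPRA2016].»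

## Road (no definitions; every step is a tree theorem)

`F ≤ Σ_γ p_γ F_γ` (convexity, g80-#1 `QFIM.qfim_convex`, with the product SLDs `S_{1,γ}⊗1 + 1⊗S_{2,γ}` of g79
`QFIProperties.sld_kronecker`); `F_γ = F_{1,γ} + F_{2,γ}` (additivity, g80-#3 `QFIMCovariance.qfim_kronecker`);
`F_{k,γ} ≤ 4Γ_{k,γ}` (g80-#3 `four_covMatrix_sub_qfim_posSemidef`); `Σ_γ p_γΓ_{k,γ} ≤ Γ_k` (concavity of the
covariance, g80-#3 `covMatrix_sub_sum_covMatrix_posSemidef`).  For local one-parameter-per-mode generators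
`Γ₁ + Γ₂ = diag((ΔĤ₁)²_{ρ̂₁}, (ΔĤ₂)²_{ρ̂₂})`, the printed right-hand side.

## What is formalized (all PROVED; two modes, finite mixtures)

* `sum_smul_unitaryDeriv` (`Σ_γ p_γ i[ρ_γ, K] = i[Σ_γ p_γρ_γ, K]`, to feed the mixture's SLD equation),
  `isHermitian_sld_kronecker`, **`qfim_modeSeparable_le`** (Eq. (12): `4(Γ₁ + Γ₂) − F ⪰ 0`),
  `qfim_modeSeparable_diag_le` (diagonal consequence `F_aa ≤ 4(Γ₁[a,a] + Γ₂[a,a])`).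

NOT formalized: `M > 2` modes (iterate), the maximisation (13) over `⟨N̂_k²⟩` and the particle-number bounds (14)–(16)
(bosonic Fock structure), `k`-producibility.  Tree search (FAIL-DUP, 2026-09-01): g79
`Entanglement/ShotNoiseLimitSeparableStates.lean` is the PARTICLE-separable one-parameter shot-noise bound; the
mode-separable matrix bound is new.
-/

noncomputable section

open Matrix Finset
open scoped ComplexOrder ComplexConjugate Kronecker

namespace Literature.InformationTheory.Entanglement.ModeSeparable

open Literature.InformationTheory.StateDiscrimination.QFIM (qfim_convex)
open Literature.InformationTheory.StateDiscrimination.QFIMCovariance (qfim_kronecker four_covMatrix_sub_qfim_posSemidef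
  covMatrix_sub_sum_covMatrix_posSemidef)
open Literature.InformationTheory.StateDiscrimination.QFIProperties (sld_kronecker)

variable {n₁ n₂ ι m : Type*} [Fintype n₁] [DecidableEq n₁] [Fintype n₂] [DecidableEq n₂] [Fintype ι] [Fintype m]

omit [Fintype ι] in
/-- Linearity of the unitary-encoding derivative in the state: `Σ_γ p_γ i(ρ_γK − Kρ_γ) = i(ρ̄K − Kρ̄)`,
`ρ̄ = Σ_γ p_γρ_γ`. [cite: GessnerPezzeSmerzi2018, (12) («`ρ̂_m-sep = Σ_γ p_γ ρ̂_{1,γ} ⊗ ⋯ ⊗ ρ̂_{M,γ}`»)] -/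
theorem sum_smul_unitaryDeriv {k : Type*} [Fintype k] (p : m → ℝ) (ρ : m → Matrix k k ℂ) (K : Matrix k k ℂ) :
    ∑ γ, (p γ : ℂ) • (Complex.I • (ρ γ * K - K * ρ γ)) =
      Complex.I • ((∑ γ, (p γ : ℂ) • ρ γ) * K - K * ∑ γ, (p γ : ℂ) • ρ γ) := by
  rw [Finset.sum_mul, Finset.mul_sum, ← Finset.sum_sub_distrib, Finset.smul_sum]
  refine Finset.sum_congr rfl fun γ _ => ?_
  rw [Matrix.smul_mul, Matrix.mul_smul, ← smul_sub, smul_comm]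

omit [Fintype n₁] [Fintype n₂] [Fintype ι] [Fintype m] in
/-- The product SLD `S₁ ⊗ 1 + 1 ⊗ S₂` is Hermitian. [cite: GessnerPezzeSmerzi2018, Supplement §1.2.2 (additivity for mode-product states)] -/
theorem isHermitian_sld_kronecker {S₁ : Matrix n₁ n₁ ℂ} {S₂ : Matrix n₂ n₂ ℂ} (h₁ : S₁.IsHermitian)
    (h₂ : S₂.IsHermitian) : (S₁ ⊗ₖ (1 : Matrix n₂ n₂ ℂ) + (1 : Matrix n₁ n₁ ℂ) ⊗ₖ S₂).IsHermitian := by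
  unfold Matrix.IsHermitian
  rw [conjTranspose_add, conjTranspose_kronecker, conjTranspose_kronecker, h₁.eq, h₂.eq, conjTranspose_one,
    conjTranspose_one]

/-- **Eq. (12), two modes: `𝐅_Q[Σ_γ p_γ ρ̂_{1,γ}⊗ρ̂_{2,γ}, Ĥ] ≤ 4(Γ₁ + Γ₂)`** where `Γ_k` is the covariance matrix
of the local generator family `h_k` in the REDUCED state `ρ̂_k = Σ_γ p_γρ̂_{k,γ}` — for any SLDs of the components
and of the mixture (`p_γ ≥ 0`, `Σp_γ = 1`, `ρ̂_{k,γ} ⪰ 0` of unit trace, `h_k a` Hermitian). For one generator per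
mode (`h₁ = (Ĥ₁,0)`, `h₂ = (0,Ĥ₂)`) the right side is `4 diag((ΔĤ₁)²_{ρ̂₁}, (ΔĤ₂)²_{ρ̂₂})`.
[cite: GessnerPezzeSmerzi2018, (12)] -/
theorem qfim_modeSeparable_le {p : m → ℝ} (hp : ∀ γ, 0 ≤ p γ) (hp1 : ∑ γ, p γ = 1)
    {ρ₁ : m → Matrix n₁ n₁ ℂ} {ρ₂ : m → Matrix n₂ n₂ ℂ} (hρ₁ : ∀ γ, (ρ₁ γ).PosSemidef) (hρ₂ : ∀ γ, (ρ₂ γ).PosSemidef)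
    (hρ₁1 : ∀ γ, (ρ₁ γ).trace = 1) (hρ₂1 : ∀ γ, (ρ₂ γ).trace = 1)
    {h₁ : ι → Matrix n₁ n₁ ℂ} {h₂ : ι → Matrix n₂ n₂ ℂ} (hh₁ : ∀ a, (h₁ a).IsHermitian) (hh₂ : ∀ a, (h₂ a).IsHermitian)
    {S₁ : m → ι → Matrix n₁ n₁ ℂ} {S₂ : m → ι → Matrix n₂ n₂ ℂ} (hS₁ : ∀ γ a, (S₁ γ a).IsHermitian)
    (hS₂ : ∀ γ a, (S₂ γ a).IsHermitian)
    (hS₁D : ∀ γ a, S₁ γ a * ρ₁ γ + ρ₁ γ * S₁ γ a = Complex.I • (ρ₁ γ * h₁ a - h₁ a * ρ₁ γ))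
    (hS₂D : ∀ γ a, S₂ γ a * ρ₂ γ + ρ₂ γ * S₂ γ a = Complex.I • (ρ₂ γ * h₂ a - h₂ a * ρ₂ γ))
    {T : ι → Matrix (n₁ × n₂) (n₁ × n₂) ℂ} (hT : ∀ a, (T a).IsHermitian)
    (hTD : ∀ a, T a * (∑ γ, (p γ : ℂ) • (ρ₁ γ ⊗ₖ ρ₂ γ)) + (∑ γ, (p γ : ℂ) • (ρ₁ γ ⊗ₖ ρ₂ γ)) * T a =
      ∑ γ, (p γ : ℂ) • (Complex.I • ((ρ₁ γ ⊗ₖ ρ₂ γ) * (h₁ a ⊗ₖ (1 : Matrix n₂ n₂ ℂ) + (1 : Matrix n₁ n₁ ℂ) ⊗ₖ h₂ a) -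
        (h₁ a ⊗ₖ (1 : Matrix n₂ n₂ ℂ) + (1 : Matrix n₁ n₁ ℂ) ⊗ₖ h₂ a) * (ρ₁ γ ⊗ₖ ρ₂ γ))))
    {F Γ₁ Γ₂ : Matrix ι ι ℝ}
    (hF : ∀ a b, F a b = 2 * (T a * ∑ γ, (p γ : ℂ) • (Complex.I • ((ρ₁ γ ⊗ₖ ρ₂ γ) *
      (h₁ b ⊗ₖ (1 : Matrix n₂ n₂ ℂ) + (1 : Matrix n₁ n₁ ℂ) ⊗ₖ h₂ b) -
        (h₁ b ⊗ₖ (1 : Matrix n₂ n₂ ℂ) + (1 : Matrix n₁ n₁ ℂ) ⊗ₖ h₂ b) * (ρ₁ γ ⊗ₖ ρ₂ γ)))).trace.re)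
    (hΓ₁ : ∀ a b, Γ₁ a b = ((∑ γ, (p γ : ℂ) • ρ₁ γ) * (h₁ a * h₁ b + h₁ b * h₁ a)).trace.re / 2 -
      ((∑ γ, (p γ : ℂ) • ρ₁ γ) * h₁ a).trace.re * ((∑ γ, (p γ : ℂ) • ρ₁ γ) * h₁ b).trace.re)
    (hΓ₂ : ∀ a b, Γ₂ a b = ((∑ γ, (p γ : ℂ) • ρ₂ γ) * (h₂ a * h₂ b + h₂ b * h₂ a)).trace.re / 2 -
      ((∑ γ, (p γ : ℂ) • ρ₂ γ) * h₂ a).trace.re * ((∑ γ, (p γ : ℂ) • ρ₂ γ) * h₂ b).trace.re) :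
    ((4 : ℝ) • (Γ₁ + Γ₂) - F).PosSemidef := by
  -- the component QFIMs and covariance matrices (as explicit matrices)
  set F₁ : m → Matrix ι ι ℝ := fun γ => Matrix.of fun a b =>
    2 * (S₁ γ a * (Complex.I • (ρ₁ γ * h₁ b - h₁ b * ρ₁ γ))).trace.re with hF₁
  set F₂ : m → Matrix ι ι ℝ := fun γ => Matrix.of fun a b =>
    2 * (S₂ γ a * (Complex.I • (ρ₂ γ * h₂ b - h₂ b * ρ₂ γ))).trace.re with hF₂
  set Fp : m → Matrix ι ι ℝ := fun γ => Matrix.of fun a b =>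
    2 * ((S₁ γ a ⊗ₖ (1 : Matrix n₂ n₂ ℂ) + (1 : Matrix n₁ n₁ ℂ) ⊗ₖ S₂ γ a) *
      (Complex.I • ((ρ₁ γ ⊗ₖ ρ₂ γ) * (h₁ b ⊗ₖ (1 : Matrix n₂ n₂ ℂ) + (1 : Matrix n₁ n₁ ℂ) ⊗ₖ h₂ b) -
        (h₁ b ⊗ₖ (1 : Matrix n₂ n₂ ℂ) + (1 : Matrix n₁ n₁ ℂ) ⊗ₖ h₂ b) * (ρ₁ γ ⊗ₖ ρ₂ γ)))).trace.re with hFp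
  set G₁ : m → Matrix ι ι ℝ := fun γ => Matrix.of fun a b =>
    (ρ₁ γ * (h₁ a * h₁ b + h₁ b * h₁ a)).trace.re / 2 - (ρ₁ γ * h₁ a).trace.re * (ρ₁ γ * h₁ b).trace.re with hG₁
  set G₂ : m → Matrix ι ι ℝ := fun γ => Matrix.of fun a b =>
    (ρ₂ γ * (h₂ a * h₂ b + h₂ b * h₂ a)).trace.re / 2 - (ρ₂ γ * h₂ a).trace.re * (ρ₂ γ * h₂ b).trace.re with hG₂
  -- (1) convexity: `Σ p_γ F_γ − F ⪰ 0`
  have hconv : (∑ γ, p γ • Fp γ - F).PosSemidef :=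
    qfim_convex (ι := ι) hp (fun γ => (hρ₁ γ).kronecker (hρ₂ γ))
      (S := fun γ a => S₁ γ a ⊗ₖ (1 : Matrix n₂ n₂ ℂ) + (1 : Matrix n₁ n₁ ℂ) ⊗ₖ S₂ γ a)
      (D := fun γ a => Complex.I • ((ρ₁ γ ⊗ₖ ρ₂ γ) * (h₁ a ⊗ₖ (1 : Matrix n₂ n₂ ℂ) + (1 : Matrix n₁ n₁ ℂ) ⊗ₖ h₂ a) -
        (h₁ a ⊗ₖ (1 : Matrix n₂ n₂ ℂ) + (1 : Matrix n₁ n₁ ℂ) ⊗ₖ h₂ a) * (ρ₁ γ ⊗ₖ ρ₂ γ)))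
      (fun γ a => isHermitian_sld_kronecker (hS₁ γ a) (hS₂ γ a)) (fun γ a => sld_kronecker (hS₁D γ a) (hS₂D γ a))
      hT hTD (Fi := Fp) (fun γ a b => rfl) hF
  -- (2) additivity: `F_γ = F_{1,γ} + F_{2,γ}`
  have hadd : ∀ γ, Fp γ = F₁ γ + F₂ γ := fun γ =>
    qfim_kronecker (hρ₁1 γ) (hρ₂1 γ) (F₁ := F₁ γ) (F₂ := F₂ γ) (F := Fp γ) (fun a b => rfl) (fun a b => rfl)
      (fun a b => rfl)
  -- (3) `F_{k,γ} ≤ 4Γ_{k,γ}`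
  have hb₁ : ∀ γ, ((4 : ℝ) • G₁ γ - F₁ γ).PosSemidef := fun γ =>
    four_covMatrix_sub_qfim_posSemidef (hρ₁ γ) (hρ₁1 γ) hh₁ (hS₁ γ) (hS₁D γ) (fun a b => rfl) (fun a b => rfl)
  have hb₂ : ∀ γ, ((4 : ℝ) • G₂ γ - F₂ γ).PosSemidef := fun γ =>
    four_covMatrix_sub_qfim_posSemidef (hρ₂ γ) (hρ₂1 γ) hh₂ (hS₂ γ) (hS₂D γ) (fun a b => rfl) (fun a b => rfl)
  -- (4) concavity of the covariance
  have hc₁ : (Γ₁ - ∑ γ, p γ • G₁ γ).PosSemidef :=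
    covMatrix_sub_sum_covMatrix_posSemidef hp hp1 (Γi := G₁) (fun γ a b => rfl) hΓ₁
  have hc₂ : (Γ₂ - ∑ γ, p γ • G₂ γ).PosSemidef :=
    covMatrix_sub_sum_covMatrix_posSemidef hp hp1 (Γi := G₂) (fun γ a b => rfl) hΓ₂
  -- (5) assemble
  have hmid : (∑ γ, p γ • (((4 : ℝ) • G₁ γ - F₁ γ) + ((4 : ℝ) • G₂ γ - F₂ γ))).PosSemidef :=
    posSemidef_sum _ fun γ _ => ((hb₁ γ).add (hb₂ γ)).smul (hp γ)
  have h4 : (0 : ℝ) ≤ 4 := by norm_num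
  have htot := (((hc₁.smul h4).add (hc₂.smul h4)).add hmid).add hconv
  have hid : (4 : ℝ) • (Γ₁ - ∑ γ, p γ • G₁ γ) + (4 : ℝ) • (Γ₂ - ∑ γ, p γ • G₂ γ) +
      ∑ γ, p γ • (((4 : ℝ) • G₁ γ - F₁ γ) + ((4 : ℝ) • G₂ γ - F₂ γ)) + (∑ γ, p γ • Fp γ - F) =
      (4 : ℝ) • (Γ₁ + Γ₂) - F := by
    simp_rw [hadd, smul_add, smul_sub, Finset.sum_add_distrib, Finset.sum_sub_distrib, smul_smul, mul_comm (p _) 4,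
      ← smul_smul, ← Finset.smul_sum]
    abel
  rwa [hid] at htot

omit [Fintype n₁] [DecidableEq n₁] [Fintype n₂] [DecidableEq n₂] [Fintype ι] [Fintype m] in
/-- Diagonal consequence: `F_aa ≤ 4(Γ₁[a,a] + Γ₂[a,a])` — for one generator per mode this is
`𝐅_Q[ρ̂_m-sep]_kk ≤ 4(ΔĤ_k)²_{ρ̂_k}`. [cite: GessnerPezzeSmerzi2018, (12)] -/
theorem qfim_modeSeparable_diag_le {F Γ₁ Γ₂ : Matrix ι ι ℝ} (h : ((4 : ℝ) • (Γ₁ + Γ₂) - F).PosSemidef) (a : ι) :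
    F a a ≤ 4 * (Γ₁ a a + Γ₂ a a) := by
  have hd := h.diag_nonneg (i := a)
  rw [Matrix.sub_apply, Matrix.smul_apply, Matrix.add_apply, smul_eq_mul] at hd
  linarith

end Literature.InformationTheory.Entanglement.ModeSeparable

end
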